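import Summits.Schanuel.Schanuel.Theorems.ZilberEacParamCurveRayRoots
import Summits.Schanuel.Schanuel.Theorems.ZilberEacGraphCurveEscapePolyLemmas
import HarnessLib

/-!
# Polynomially parametrised base curves, IX: the directional escape engine with polynomial
# coefficients (towards NON-SPLIT surfaces over a polynomial curve)

HONEST FRAMING.  Cell `pub-schanuel` (Zilber's Exponential-Algebraic Closedness, case ladder;
host summit Schanuel), seat 2, gen 19.  Over a polynomial curve `C = g(ℂ)` the surfaces of
Mantova–Masser's case need not be products: `W = {(g(t), y) : Q(t; y₀, y₁) = 0}` with the fibre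
curve moving with the parameter.  Along `C`, `Q(t; e^{g₀(t)}, e^{g₁(t)}) = Σ_m c_m t^{m₀}
e^{m₁ g₀(t) + m₂ g₁(t)}` is an exponential sum with POLYNOMIAL coefficients in `t`; this file ports
gen 16's engine with polynomial coefficients (`exists_escape_zeros_poly`) to the directional setting
of file III: `exists_escape_zeros_poly_dir`.  The density theorems built on it are instances of
Mantova–Masser's OPEN question (PLMS 2024, §1 p. 5); NOT Schanuel's conjecture (neither used nor
implied; EAC ⇏ SC); `EC(3,2)` stays OPEN.

THE ENGINE.  `R` of degree `d ≥ 2` with a root direction `ω` (`lc(R) ω^d = ±2πi`); `G` of degree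
`m ≥ 1` with `Re(lc(G) ω^m) < 0`; coefficients `q_j ∈ ℂ[t]` of degree `≤ n` whose top polynomial
`Σ_j [tⁿ]q_j X^{e_j}` is nonzero with a root `θ ≠ 0`; `E` entire with
`‖E(t)‖ ≤ C_B (1 + ‖t‖)^N e^{δ Re G(t)}` for `Re G(t) ≤ 0`, `|Re R(t)| ≤ B`.  Then
`Σ_j q_j(t) e^{e_j R(t)} + E(t)` has zeros `t_k` with `Re G(t_k) ≤ -L_k`, `‖G(t_k)‖ ≤ A L_k`,
`L_k → ∞`.  Proof = gen 16's (rescaling by `z₀ⁿ`, coefficient tails `≤ K_j/‖z₀‖`) with the stage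
roots ON the ray (file II) so that `Re G ≤ -(A₀/2)(k+1)^m` on the unit disc around them, which beats
the polynomial weight `(1 + ‖t‖)^N`.
-/

noncomputable section

open Filter Topology Metric Set Complex Polynomial
open Literature.ModelTheory.Zilber

set_option linter.dupNamespace false

namespace Summit.Schanuel.Schanuel.Theorems

/-! ## Part B. The engine with polynomial coefficients -/

/-- **The directional escape engine with polynomial coefficients.**  See the module docstring.
(new) -/
theorem exists_escape_zeros_poly_dir {ι : Type*} (R G : Polynomial ℂ) (hd : 2 ≤ R.natDegree)
    (hm : 1 ≤ G.natDegree) (J : Finset ι) (q : ι → Polynomial ℂ) (e : ι → ℕ) (n : ℕ)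
    (hq : ∀ j ∈ J, (q j).natDegree ≤ n) {θ : ℂ} (hθ0 : θ ≠ 0)
    (hθ : (∑ j ∈ J, Polynomial.C ((q j).coeff n) * Polynomial.X ^ (e j)).eval θ = 0)
    (hQ : (∑ j ∈ J, Polynomial.C ((q j).coeff n) * Polynomial.X ^ (e j)) ≠ 0)
    (ω : ℂ) (s : ℤ) (hs : s = 1 ∨ s = -1)
    (hω : R.leadingCoeff * ω ^ R.natDegree = 2 * Real.pi * I * s)
    (hdir : (G.leadingCoeff * ω ^ G.natDegree).re < 0)
    (E : ℂ → ℂ) (hE : Differentiable ℂ E) {δ : ℝ} (hδ : 0 < δ)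
    (hEb : ∀ B : ℝ, ∃ C : ℝ, 0 ≤ C ∧ ∃ N : ℕ,
      ∀ t : ℂ, (G.eval t).re ≤ 0 → |(R.eval t).re| ≤ B →
        ‖E t‖ ≤ C * (1 + ‖t‖) ^ N * Real.exp (δ * (G.eval t).re)) :
    ∃ (t : ℕ → ℂ) (L : ℕ → ℝ) (A : ℝ), Tendsto L atTop atTop ∧
      ∀ k, (∑ j ∈ J, (q j).eval (t k) * exp (R.eval (t k)) ^ (e j)) + E (t k) = 0 ∧
        (G.eval (t k)).re ≤ -L k ∧ ‖G.eval (t k)‖ ≤ A * L k := by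
  classical
  -- notation
  set Qt : Polynomial ℂ := ∑ j ∈ J, Polynomial.C ((q j).coeff n) * Polynomial.X ^ (e j) with hQt
  set d : ℕ := R.natDegree with hd_def
  set a : ℂ := R.leadingCoeff with ha_def
  set ℓ : Polynomial ℂ := R.eraseLead with hℓ_def
  have hR0 : R ≠ 0 := by
    rintro rfl
    rw [hd_def, Polynomial.natDegree_zero] at hd
    omega
  have ha0 : a ≠ 0 := Polynomial.leadingCoeff_ne_zero.2 hR0
  have hapos : 0 < ‖a‖ := norm_pos_iff.2 ha0
  set c₀ : ℂ := Complex.log θ with hc₀_def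
  have hc₀ : exp c₀ = θ := Complex.exp_log hθ0
  -- the limit function `h(u) = Q_top(θ e^u)`
  set h : ℂ → ℂ := fun u => Qt.eval (θ * exp u) with hh_def
  have hh : Differentiable ℂ h :=
    (Polynomial.differentiable Qt).comp ((differentiable_const θ).mul differentiable_exp)
  have hh0 : h 0 = 0 := by
    simp only [hh_def, Complex.exp_zero, mul_one]; exact hθ
  have hhne : ∃ u, h u ≠ 0 := by
    by_contra hall
    push Not at hall
    have hinf : Set.Infinite {x : ℂ | Qt.IsRoot x} := by
      have hinj : Function.Injective (fun t : ℝ => θ * exp (t : ℂ)) := by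
        intro t₁ t₂ ht
        have h1 : exp (t₁ : ℂ) = exp (t₂ : ℂ) := mul_left_cancel₀ hθ0 ht
        have h2 : Real.exp t₁ = Real.exp t₂ := by
          have := congrArg norm h1
          rwa [Complex.norm_exp, Complex.norm_exp, Complex.ofReal_re, Complex.ofReal_re] at this
        exact Real.exp_injective h2
      have hsub : Set.range (fun t : ℝ => θ * exp (t : ℂ)) ⊆ {x : ℂ | Qt.IsRoot x} := by
        rintro _ ⟨t, rfl⟩
        exact hall t
      exact (Set.infinite_range_of_injective hinj).mono hsub
    exact hQ (Polynomial.eq_zero_of_infinite_isRoot Qt hinf)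
  -- the stage roots
  obtain ⟨z₀, Λ, Λ', A, hΛ, hΛ', hΛnn, hΛ'nn, hdecay, hz₀all⟩ :=
    exists_ray_roots R G hd hm ω s hs hω hdir c₀
  have hz₀θ : ∀ j, exp (R.eval (z₀ j)) = θ := fun j => by rw [(hz₀all j).1, hc₀]
  have hz₀re : ∀ j, (R.eval (z₀ j)).re = Real.log ‖θ‖ := fun j => by
    rw [(hz₀all j).2.1, hc₀_def, Complex.log_re]
  have hz₀1 : ∀ j, 1 ≤ ‖z₀ j‖ := fun j => (hz₀all j).2.2.1
  have hz₀2 : ∀ j, 2 ≤ ‖a‖ * ‖z₀ j‖ := fun j => (hz₀all j).2.2.2.1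
  have hz₀low : ∀ j, Λ j / 3 ≤ ‖z₀ j‖ := fun j => (hz₀all j).2.2.2.2.1
  have hz₀up : ∀ j, ‖z₀ j‖ ≤ 3 * Λ j := fun j => (hz₀all j).2.2.2.2.2.1
  have hz₀G : ∀ j (z : ℂ), ‖z - z₀ j‖ ≤ 1 → (G.eval z).re ≤ -Λ' j ∧ ‖G.eval z‖ ≤ A * Λ' j :=
    fun j => (hz₀all j).2.2.2.2.2.2
  have hz₀ne : ∀ j, z₀ j ≠ 0 := fun j => norm_pos_iff.1 (by linarith [hz₀1 j])
  -- the remainder constant and the local coordinates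
  set K : ℝ := 1 / ‖a‖ + coeffNormSum ℓ * ((d - 1 : ℕ) : ℝ) * 2 ^ (d - 1) / ‖a‖ with hK_def
  set φ : ℕ → ℂ → ℂ := fun j u =>
    z₀ j * exp (u / ((R.natDegree : ℂ) * (R.leadingCoeff * z₀ j ^ R.natDegree))) with hφ_def
  have hRem : ∀ j (u : ℂ), ‖u‖ ≤ 1 → ‖R.eval (φ j u) - R.eval (z₀ j) - u‖ ≤ K / ‖z₀ j‖ :=
    fun j u hu => norm_gceRem_le hd (hz₀1 j) (hz₀2 j) hu
  have hdisp : ∀ j (u : ℂ), ‖u‖ ≤ 1 → ‖φ j u - z₀ j‖ ≤ 1 := fun j u hu => by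
    obtain ⟨h1, h2⟩ := norm_gcePhi_sub_le (R := R) (z₀ := z₀ j) hd (hz₀1 j) (hz₀2 j) hu
    exact h1.trans h2
  have hz₀norm : Tendsto (fun j => ‖z₀ j‖) atTop atTop :=
    tendsto_atTop_mono (fun j => hz₀low j) (hΛ.atTop_div_const (by norm_num : (0 : ℝ) < 3))
  -- coefficient ratios
  set Kq : ι → ℝ := fun j =>
    (coeffNormSum (q j) + coeffNormSum (q j).eraseLead + n * ‖(q j).coeff n‖) * 2 ^ n with hKq
  have hKq0 : ∀ j, 0 ≤ Kq j := fun j => by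
    have := coeffNormSum_nonneg (q j); have := coeffNormSum_nonneg (q j).eraseLead
    simp only [hKq]; positivity
  have hratio : ∀ j ∈ J, ∀ i (u : ℂ), ‖u‖ ≤ 1 →
      ‖(q j).eval (φ i u) / z₀ i ^ n - (q j).coeff n‖ ≤ Kq j / ‖z₀ i‖ :=
    fun j hj i u hu => norm_eval_div_pow_sub_coeff_le (q j) (hq j hj) (hz₀1 i) (hdisp i u hu)
  -- the rescaled functions
  set g : ℂ → ℂ := fun z => (∑ j ∈ J, (q j).eval z * exp (R.eval z) ^ (e j)) + E z with hg_def
  set Gf : ℕ → ℂ → ℂ := fun i u => g (φ i u) / z₀ i ^ n with hGf_def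
  have hgdiff : Differentiable ℂ g := by
    refine (Differentiable.fun_sum fun j _ => ?_).add hE
    exact (Polynomial.differentiable _).mul ((Polynomial.differentiable R).cexp.pow _)
  have hGfdiff : ∀ i, Differentiable ℂ (Gf i) := by
    intro i
    have hφ : Differentiable ℂ (φ i) := differentiable_gcePhi R (z₀ i)
    exact (hgdiff.comp hφ).div_const _
  have hkey : ∀ i (u : ℂ), exp (R.eval (φ i u)) =
      θ * exp (u + (R.eval (φ i u) - R.eval (z₀ i) - u)) := by
    intro i u
    rw [← hz₀θ i, ← Complex.exp_add]
    congr 1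
    ring
  -- uniform approximation on `closedBall 0 1`
  obtain ⟨C, hC0, N, hC⟩ := hEb (|Real.log ‖θ‖| + 2)
  set W : ℝ := ‖θ‖ * Real.exp 2 with hW
  have hunif : ∀ η : ℝ, 0 < η → ∀ᶠ i in atTop, ∀ u ∈ closedBall (0 : ℂ) 1, ‖Gf i u - h u‖ < η := by
    intro η hη
    have hη3 : 0 < η / 3 := by positivity
    obtain ⟨β, hβ, hβh⟩ := Metric.uniformContinuousOn_iff.1
      ((isCompact_closedBall (0 : ℂ) 2).uniformContinuousOn_of_continuous hh.continuous.continuousOn)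
      (η / 3) hη3
    have hevR : ∀ᶠ i in atTop, K / ‖z₀ i‖ < min β 1 :=
      (tendsto_const_nhds.div_atTop hz₀norm).eventually (gt_mem_nhds (lt_min hβ zero_lt_one))
    have hevT : ∀ᶠ i in atTop, (∑ j ∈ J, Kq j * W ^ (e j)) / ‖z₀ i‖ < η / 3 :=
      (tendsto_const_nhds.div_atTop hz₀norm).eventually (gt_mem_nhds hη3)
    have hevE : ∀ᶠ i in atTop, C * ((2 + 3 * Λ i) ^ N * Real.exp (-(δ * Λ' i))) < η / 3 := by
      have h1 := (hdecay N δ hδ).const_mul C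
      rw [mul_zero] at h1
      exact h1.eventually (gt_mem_nhds hη3)
    filter_upwards [hevR, hevT, hevE] with i hiR hiT hiE u hu
    rw [mem_closedBall, dist_zero_right] at hu
    set ρ : ℂ := R.eval (φ i u) - R.eval (z₀ i) - u with hρ_def
    have hRem1 : ‖ρ‖ < min β 1 := (hRem i u hu).trans_lt hiR
    have hRemβ : ‖ρ‖ < β := hRem1.trans_le (min_le_left _ _)
    have hRem1' : ‖ρ‖ ≤ 1 := (hRem1.trans_le (min_le_right _ _)).le
    have hw : ‖θ * exp (u + ρ)‖ ≤ W := by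
      rw [norm_mul, Complex.norm_exp, hW]
      refine mul_le_mul_of_nonneg_left (Real.exp_le_exp.2 ?_) (norm_nonneg _)
      have := re_le_norm (u + ρ)
      have := norm_add_le u ρ
      linarith
    -- (1) the top term
    have hQterm : ‖Qt.eval (θ * exp (u + ρ)) - h u‖ < η / 3 := by
      have hmem1 : u + ρ ∈ closedBall (0 : ℂ) 2 := by
        rw [mem_closedBall, dist_zero_right]
        exact (norm_add_le _ _).trans (by linarith)
      have hmem2 : u ∈ closedBall (0 : ℂ) 2 := by
        rw [mem_closedBall, dist_zero_right]; linarith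
      have hdist : dist (u + ρ) u < β := by
        rw [dist_eq_norm, add_sub_cancel_left]; exact hRemβ
      have := hβh _ hmem1 _ hmem2 hdist
      rwa [dist_eq_norm] at this
    -- (2) the coefficient-tail term
    have hTterm :
        ‖∑ j ∈ J, ((q j).eval (φ i u) / z₀ i ^ n - (q j).coeff n) * (θ * exp (u + ρ)) ^ (e j)‖
        < η / 3 := by
      refine lt_of_le_of_lt ?_ hiT
      rw [Finset.sum_div]
      refine (norm_sum_le _ _).trans (Finset.sum_le_sum fun j hj => ?_)
      rw [norm_mul, norm_pow]
      calc ‖(q j).eval (φ i u) / z₀ i ^ n - (q j).coeff n‖ * ‖θ * exp (u + ρ)‖ ^ (e j)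
          ≤ Kq j / ‖z₀ i‖ * W ^ (e j) :=
            mul_le_mul (hratio j hj i u hu) (pow_le_pow_left₀ (norm_nonneg _) hw (e j))
              (by positivity) (div_nonneg (hKq0 j) (norm_nonneg _))
        _ = Kq j * W ^ (e j) / ‖z₀ i‖ := by ring
    -- (3) the `E`-term
    have hEterm : ‖E (φ i u) / z₀ i ^ n‖ < η / 3 := by
      have hGre : (G.eval (φ i u)).re ≤ -Λ' i := (hz₀G i (φ i u) (hdisp i u hu)).1
      have hre0 : (G.eval (φ i u)).re ≤ 0 := hGre.trans (by linarith [hΛ'nn i])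
      have hReR : |(R.eval (φ i u)).re| ≤ |Real.log ‖θ‖| + 2 := by
        have e1 : (R.eval (φ i u)).re = Real.log ‖θ‖ + (u.re + ρ.re) := by
          rw [← hz₀re i, ← Complex.add_re, ← Complex.add_re]
          congr 1
          rw [hρ_def]; ring
        rw [e1]
        have h1 := abs_re_le_norm u
        have h2 := abs_re_le_norm ρ
        have h3 := abs_add_le (Real.log ‖θ‖) (u.re + ρ.re)
        have h4 := abs_add_le u.re ρ.re
        linarith
      have h5 := hC _ hre0 hReR
      have hnorm : ‖φ i u‖ ≤ 1 + 3 * Λ i := by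
        have := norm_le_insert' (φ i u) (z₀ i)
        linarith [hdisp i u hu, hz₀up i]
      have hden : 1 ≤ ‖z₀ i ^ n‖ := by rw [norm_pow]; exact one_le_pow₀ (hz₀1 i)
      have hδre : δ * (G.eval (φ i u)).re ≤ -(δ * Λ' i) := by
        have := mul_le_mul_of_nonneg_left hGre hδ.le
        linarith
      rw [norm_div]
      calc ‖E (φ i u)‖ / ‖z₀ i ^ n‖ ≤ ‖E (φ i u)‖ := div_le_self (norm_nonneg _) hden
        _ ≤ C * (1 + ‖φ i u‖) ^ N * Real.exp (δ * (G.eval (φ i u)).re) := h5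
        _ ≤ C * ((2 + 3 * Λ i) ^ N * Real.exp (-(δ * Λ' i))) := by
            rw [mul_assoc]
            refine mul_le_mul_of_nonneg_left ?_ hC0
            exact mul_le_mul (pow_le_pow_left₀ (by positivity) (by linarith) N)
              (Real.exp_le_exp.2 hδre) (Real.exp_nonneg _)
              (pow_nonneg (by linarith [hΛnn i]) N)
        _ < η / 3 := hiE
    -- assemble
    have hGsplit : Gf i u - h u = (Qt.eval (θ * exp (u + ρ)) - h u) +
        (∑ j ∈ J, ((q j).eval (φ i u) / z₀ i ^ n - (q j).coeff n) * (θ * exp (u + ρ)) ^ (e j)) +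
        E (φ i u) / z₀ i ^ n := by
      have hQte : Qt.eval (θ * exp (u + ρ)) =
          ∑ j ∈ J, (q j).coeff n * (θ * exp (u + ρ)) ^ (e j) := by
        rw [hQt, Polynomial.eval_finsetSum]
        refine Finset.sum_congr rfl fun j _ => ?_
        rw [Polynomial.eval_mul, Polynomial.eval_C, Polynomial.eval_pow, Polynomial.eval_X]
      rw [hGf_def, hg_def]
      simp only []
      rw [add_div, Finset.sum_div, hkey i u, hQte]
      have : ∑ j ∈ J, (q j).eval (φ i u) * (θ * exp (u + ρ)) ^ (e j) / z₀ i ^ n =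
          ∑ j ∈ J, ((q j).eval (φ i u) / z₀ i ^ n - (q j).coeff n) * (θ * exp (u + ρ)) ^ (e j) +
            ∑ j ∈ J, (q j).coeff n * (θ * exp (u + ρ)) ^ (e j) := by
        rw [← Finset.sum_add_distrib]
        refine Finset.sum_congr rfl fun j _ => ?_
        ring
      rw [this]
      ring
    rw [hGsplit]
    calc ‖(Qt.eval (θ * exp (u + ρ)) - h u) +
          (∑ j ∈ J, ((q j).eval (φ i u) / z₀ i ^ n - (q j).coeff n) * (θ * exp (u + ρ)) ^ (e j)) +
          E (φ i u) / z₀ i ^ n‖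
        ≤ ‖Qt.eval (θ * exp (u + ρ)) - h u‖ +
          ‖∑ j ∈ J, ((q j).eval (φ i u) / z₀ i ^ n - (q j).coeff n) * (θ * exp (u + ρ)) ^ (e j)‖ +
          ‖E (φ i u) / z₀ i ^ n‖ := norm_add₃_le
      _ < η / 3 + η / 3 + η / 3 := by gcongr
      _ = η := by ring
  -- persistence
  have hzeros := eventually_exists_zero_of_unif_approx hh hhne hh0 hGfdiff zero_lt_one hunif
  obtain ⟨K₁, hK₁⟩ := eventually_atTop.1 hzeros
  have hsol : ∀ k : ℕ, ∃ u : ℂ, ‖u‖ ≤ 1 ∧ Gf (k + K₁) u = 0 := by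
    intro k
    obtain ⟨u, hu, hu0⟩ := hK₁ (k + K₁) (Nat.le_add_left _ _)
    rw [mem_ball, dist_zero_right] at hu
    exact ⟨u, hu.le, hu0⟩
  choose u hu1 hu0 using hsol
  refine ⟨fun k => φ (k + K₁) (u k), fun k => Λ' (k + K₁), A, hΛ'.comp (tendsto_add_atTop_nat K₁),
    fun k => ⟨?_, (hz₀G (k + K₁) _ (hdisp _ _ (hu1 k))).1, (hz₀G (k + K₁) _ (hdisp _ _ (hu1 k))).2⟩⟩
  have h0 := hu0 k
  have hzn : z₀ (k + K₁) ^ n ≠ 0 := pow_ne_zero _ (hz₀ne _)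
  have : g (φ (k + K₁) (u k)) = 0 := by
    rw [hGf_def] at h0
    exact (div_eq_zero_iff.1 h0).resolve_right hzn
  simpa [hg_def] using this

end Summit.Schanuel.Schanuel.Theorems
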